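import Summits.HodgeConjecture.HodgeConjecture.Theorems.HeckePrymWeilHeckePrymAnchorsUpgrade
import Summits.HodgeConjecture.HodgeConjecture.Theorems.WeilTwelvefoldsSqrtMinus7.Negative.EigenvalueTyping
import Literature.AlgebraicGeometry.HodgeTheory.WeilClassesIsogenyDescent
import Literature.AlgebraicGeometry.HodgeTheory.HodgeConjectureQbarVoisinProofs
import Literature.AlgebraicGeometry.HodgeTheory.WeilClassesSixfoldsProofs
import Literature.AlgebraicGeometry.Motives.AbelianVarietyCohomologyExteriorH1
import HarnessLib

/-!
# Crux `WeilTwelvefoldsSqrtMinus7` (stmt-HodgeConjecture-1261), line `polya-glued-box-products` ·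
# stub 7 `stub_typedPlaneTransfer`: typed Weil-plane saturation and isogeny transfer

Route `HeckePrymWeil` (sub-problem `HodgeConjecture`); lead seat c7 of crux `WeilTwelvefoldsSqrtMinus7`,
line `polya-glued-box-products`, reshape r1.  This file proves the registered stub
`stub_typedPlaneTransfer` VERBATIM (the body of the skeleton's `TypedPlaneTransfer` with the local
notations expanded), unconditionally and `sorry`-free.

Statement.  Let `(A, φ)` and `(A″, φ″)` be complex abelian twelvefolds with `φ ≫ φ = -7`,
`φ″ ≫ φ″ = -7`, and an isogeny pair `f₁ : A ⟶ A″` (flat), `g₁ : A″ ⟶ A` `K`-equivariant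
(`g₁ ≫ φ = φ″ ≫ g₁`), `f₁ ≫ g₁ = m • 𝟙 A`, `m ≥ 1`.  If ONE class `v₊ + v₋` of `A″` with
`v₊ ∈ Eig((𝟙+φ″)^*, (1+i√7)¹²)`, `v₋ ∈ Eig((𝟙+φ″)^*, (1-i√7)¹²)`, both non-zero, is algebraic, then
EVERY class of the typed Weil plane `Eig((𝟙+φ)^*, (1+i√7)¹²) ⊔ Eig((𝟙+φ)^*, (1-i√7)¹²)` of `A` is
algebraic.

Proof (assembly of PROVED tree lemmas; van Geemen LNM 1594, 3.6–3.7 and proof of Thm. 6.12;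
Markman arXiv:2509.23403 §11.5 Step 1):
* `v₊ + v₋` lies in the typed plane of `A″`, hence (typing upgrade `stub_upgrade`, PROVED) in the
  strong Weil plane `weilClassesOf A″ φ″ 6 7`; it is non-zero because the two typed eigenvalues
  differ (`Negative.weilEigenvalues_twelve_ne`), so `v₊ + v₋ = 0` would force `v₊ = 0`;
* one non-zero algebraic strong Weil class makes the whole strong plane of `A″` algebraic
  (`weilClassesOf_le_algebraicClasses_iff_exists_ne_zero_of_dim_eq` with the PROVED named fact
  `abelianVarietyCohomologyExteriorH1_holds`);
* for `c` in the typed plane of `A`: `c ∈ weilClassesOf A φ 6 7` (`stub_upgrade`), `g₁^* c` lies in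
  the strong plane of `A″` (`map_mem_weilClassesOf_of_comm`), hence is algebraic; its flat pull-back
  `f₁^* g₁^* c = (f₁ ≫ g₁)^* c = (m • 𝟙 A)^* c = m¹² • c` is algebraic
  (`map_mem_algebraicClasses_of_flat`, `abelianVarietyHom_map_map_apply`,
  `map_nsmul_id_eq_of_mem_weilClassesOf`), and `m¹² ≠ 0`.

No `sorry`, no new definition, no hypothesis beyond the registered signature.
-/

noncomputable section

-- every declaration of this problem lives in `Summit.HodgeConjecture.HodgeConjecture.…` (summit = sub-problem)
set_option linter.dupNamespace false

open CategoryTheory AlgebraicGeometry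

namespace Summit.HodgeConjecture.HodgeConjecture.Theorems.WeilTwelvefoldsSqrtMinus7.PolyaGluedBoxProducts

open Literature.AlgebraicGeometry Literature.AlgebraicGeometry.Motives Literature.AlgebraicGeometry.HodgeTheory
open Literature.AlgebraicTopology.SingularHomology
open Summit.HodgeConjecture.HodgeConjecture.Theorems.HeckePrymWeilLine

/-- **Stub 7 `stub_typedPlaneTransfer` — typed Weil-plane saturation and isogeny transfer**
(registered signature, UNCONDITIONAL).  For complex abelian twelvefolds `(A, φ)`, `(A″, φ″)` with
`φ² = φ″² = -7` and an isogeny pair `f₁ : A ⟶ A″` (flat), `g₁ : A″ ⟶ A` (`g₁ ≫ φ = φ″ ≫ g₁`),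
`f₁ ≫ g₁ = m • 𝟙 A`, `m ≥ 1`: one algebraic class `v₊ + v₋` on `A″` with both typed Weil components
`v± ∈ Eig((𝟙+φ″)^*, (1 ± i√7)¹²)` non-zero makes every class of the typed Weil plane
`Eig((𝟙+φ)^*, (1+i√7)¹²) ⊔ Eig((𝟙+φ)^*, (1-i√7)¹²)` of `A` algebraic: the strong Weil plane of `A″`
is algebraic as soon as it carries one non-zero algebraic class, `g₁^*` maps the plane of `A` into
that of `A″`, and `f₁^* g₁^* = (m • 𝟙)^* = m¹²` on it.
[cite: vanGeemen1994HodgeAV, 3.6–3.7 and proof of Thm. 6.12]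
[cite: Markman2025SurveySecant, §11.5 Step 1] [cite: Milne1986AbelianVarieties, §8 Prop. 8.1] -/
theorem stub_typedPlaneTransfer :
    ∀ (A A'' : AbelianVariety ℂ) (φ : A ⟶ A) (φ'' : A'' ⟶ A''), A.dim = 12 → A''.dim = 12 →
      φ ≫ φ = -((7 : ℤ) • 𝟙 A) → φ'' ≫ φ'' = -((7 : ℤ) • 𝟙 A'') →
    ∀ (f₁ : A ⟶ A'') (g₁ : A'' ⟶ A) (m : ℕ), Flat f₁.hom.hom.hom.left → 0 < m →
      f₁ ≫ g₁ = m • 𝟙 A → g₁ ≫ φ = φ'' ≫ g₁ →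
    ∀ (vp vm : complexBetti A''.X 12),
      vp ∈ Module.End.eigenspace (complexBetti.map (𝟙 A'' + φ'').hom.hom.hom 12).hom
          ((1 + Complex.I * (Real.sqrt (7 : ℝ) : ℂ)) ^ 12) →
      vm ∈ Module.End.eigenspace (complexBetti.map (𝟙 A'' + φ'').hom.hom.hom 12).hom
          ((1 - Complex.I * (Real.sqrt (7 : ℝ) : ℂ)) ^ 12) →
      vp ≠ 0 → vm ≠ 0 → vp + vm ∈ algebraicClasses A''.X 6 →
    ∀ c : complexBetti A.X 12,
      c ∈ Module.End.eigenspace (complexBetti.map (𝟙 A + φ).hom.hom.hom 12).hom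
            ((1 + Complex.I * (Real.sqrt (7 : ℝ) : ℂ)) ^ 12) ⊔
          Module.End.eigenspace (complexBetti.map (𝟙 A + φ).hom.hom.hom 12).hom
            ((1 - Complex.I * (Real.sqrt (7 : ℝ) : ℂ)) ^ 12) →
      c ∈ algebraicClasses A.X 6 := by
  intro A A'' φ φ'' hA hA'' hφ hφ'' f₁ g₁ m hflat hm hfg hg vp vm hvp hvm hvp0 _ halg c hc
  have h7 : Nat.Prime 7 := by norm_num
  have hA2 : A.dim = 2 * 6 := by rw [hA]
  have hA''2 : A''.dim = 2 * 6 := by rw [hA'']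
  have hφz : φ ≫ φ = -(((7 : ℕ) : ℤ) • 𝟙 A) := by exact_mod_cast hφ
  have hφ''z : φ'' ≫ φ'' = -(((7 : ℕ) : ℤ) • 𝟙 A'') := by exact_mod_cast hφ''
  have hφ''n : φ'' ≫ φ'' = -((7 : ℕ) • 𝟙 A'') := by rw [hφ'', ← natCast_zsmul]; rfl
  -- (b) `vp + vm` lies in the typed plane of `A″`, hence in its strong Weil plane
  have hW'' : vp + vm ∈ weilClassesOf A'' φ'' 6 7 :=
    stub_upgrade 7 h7 (by norm_num) le_rfl 6 A'' φ'' hA''2 hφ''z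
      (by exact_mod_cast Submodule.add_mem_sup hvp hvm)
  -- (c) `vp + vm ≠ 0`: the two typed eigenvalues differ, so `vm = -vp` would force `vp = 0`
  have hne : vp + vm ≠ 0 := by
    intro h0
    have hvm' : vm = -vp := eq_neg_of_add_eq_zero_right h0
    rw [hvm', Submodule.neg_mem_iff, Module.End.mem_eigenspace_iff] at hvm
    rw [Module.End.mem_eigenspace_iff] at hvp
    have hsmul : ((1 + Complex.I * (Real.sqrt (7 : ℝ) : ℂ)) ^ 12 -
        (1 - Complex.I * (Real.sqrt (7 : ℝ) : ℂ)) ^ 12) • vp = 0 := by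
      rw [sub_smul, ← hvp, ← hvm, sub_self]
    exact hvp0 ((smul_eq_zero.mp hsmul).resolve_left
      (sub_ne_zero.mpr Negative.weilEigenvalues_twelve_ne))
  -- (d) one non-zero algebraic strong Weil class makes the whole strong plane of `A″` algebraic
  have hle'' : weilClassesOf A'' φ'' 6 7 ≤ algebraicClasses A''.X 6 :=
    (weilClassesOf_le_algebraicClasses_iff_exists_ne_zero_of_dim_eq
      abelianVarietyCohomologyExteriorH1_holds hA''2 (by norm_num) (by norm_num) hφ''n).mpr
      ⟨vp + vm, hW'', halg, hne⟩
  -- (e) transfer to `A`: `c` is a strong Weil class, `g₁^* c` is algebraic on `A″`, and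
  -- `f₁^* g₁^* c = (m • 𝟙 A)^* c = m¹² • c` is algebraic on `A`
  have hcW : c ∈ weilClassesOf A φ 6 7 :=
    stub_upgrade 7 h7 (by norm_num) le_rfl 6 A φ hA2 hφz (by exact_mod_cast hc)
  have hgc : singularCohomology.map ℂ ℂ (Motives.AlgPoints.mapContinuous (L := ℂ) g₁.hom.hom.hom)
      (2 * 6) c ∈ algebraicClasses A''.X 6 :=
    hle'' (map_mem_weilClassesOf_of_comm hg hcW)
  haveI : IsLocallyNoetherian A.X.left := LocallyOfFiniteType.isLocallyNoetherian A.X.hom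
  haveI : IsLocallyNoetherian A''.X.left := LocallyOfFiniteType.isLocallyNoetherian A''.X.hom
  haveI : Flat f₁.hom.hom.hom.left := hflat
  have hfc := map_mem_algebraicClasses_of_flat f₁.hom.hom.hom hgc
  have key : complexBetti.map f₁.hom.hom.hom (2 * 6)
      (singularCohomology.map ℂ ℂ (Motives.AlgPoints.mapContinuous (L := ℂ) g₁.hom.hom.hom)
        (2 * 6) c) = ((m : ℂ) ^ (2 * 6)) • c := by
    change singularCohomology.map ℂ ℂ (Motives.AlgPoints.mapContinuous (L := ℂ) f₁.hom.hom.hom)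
      (2 * 6) (singularCohomology.map ℂ ℂ
        (Motives.AlgPoints.mapContinuous (L := ℂ) g₁.hom.hom.hom) (2 * 6) c) = _
    rw [abelianVarietyHom_map_map_apply, hfg, map_nsmul_id_eq_of_mem_weilClassesOf m hcW]
  rw [key] at hfc
  have hmC : ((m : ℂ) ^ (2 * 6)) ≠ 0 := pow_ne_zero _ (Nat.cast_ne_zero.mpr hm.ne')
  have h := Submodule.smul_mem (algebraicClasses A.X 6) (((m : ℂ) ^ (2 * 6))⁻¹) hfc
  rwa [smul_smul, inv_mul_cancel₀ hmC, one_smul] at h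

end Summit.HodgeConjecture.HodgeConjecture.Theorems.WeilTwelvefoldsSqrtMinus7.PolyaGluedBoxProducts

end
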